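import Summits.AtomisticToContinuum.BoseEinsteinCondensation.Theses.BECHeatBathGap
import Summits.AtomisticToContinuum.BoseEinsteinCondensation.Theorems.BECHeatBathGapSquareSummableInfluenceGroundStateForm
import Summits.AtomisticToContinuum.BoseEinsteinCondensation.Theorems.BECHeatBathGapSquareSummableInfluenceStubInfluenceLipschitz
import Summits.AtomisticToContinuum.BoseEinsteinCondensation.Theorems.BECHeatBathGapSquareSummableInfluenceExistence
import Summits.AtomisticToContinuum.BoseEinsteinCondensation.Theorems.BECCutLineWeakDisorderGroundStateRigidityStubCompactness
import Summits.AtomisticToContinuum.BoseEinsteinCondensation.Theorems.BECCutLineWeakDisorderGroundStateRigidityStubRigidityOfUnique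
import Literature.MathematicalPhysics.QuantumManyBody.GroundState
import HarnessLib

/-!
# Route `BECHeatBathGap`, crux `SquareSummableInfluence` (stmt-AtomisticToContinuum-14368), line `registered`:
# the crux follows from the ALL-GROUND-STATES pair form alone (no nondegeneracy, no stmt-9072 input)

Supports (does not close) stmt-AtomisticToContinuum-14368 (lead c3, skeleton v3). The registered reduction of
skeleton v2 (`squareSummableInfluence_of_kernels`, p148333) closes the crux from the pair form of the physics
`∃ Θ₀ ∃ Ψ₀ (ground states) ∃ g, ∑_i ∫ |Ψ₀ − g_i Θ₀(tail)|² ≤ ε` AND the nondegeneracy of the `N`-body ground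
state in the `(N+1)`-box (hard-wall uniqueness kernel `stub_levelUniqueWall`, shared with stmt-9072 and blocked
on it). This file removes the second input altogether by re-typing the physics over ALL ground states:

* `stub_uniformWindow` (frame): at fixed `(N, L, v)` with `E₀(N, L) < ⊤`, if EVERY ground state `Θ₀` of `N`
  bodies is predicted with tolerance `ε` from some `(N+1)`-body ground state `Ψ₀` by bounded measurable
  predictors blind to `x_i`, then on some slack window `δ₂ > 0` every `δ₂`-near-minimiser `Θ` is so predicted
  with tolerance `3ε`. Proof by contradiction: badly predicted near-minimisers of slack `1/(n+1)` have, by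
  compactness of bounded-energy sequences (`stub_compactness`, Rellich on the box), an `L²`-convergent
  subsequence whose limit is a ground state (`IsGroundState.of_tendstoL2`); the predictors of that ground
  state serve the tail of the subsequence by the `L²`-Lipschitz estimate `stub_influenceLipschitz`.
  No uniqueness and no phase enter.
* `squareSummableInfluence_of_allGroundStatesForm` (REDUCTION v3): the all-ground-states pair form, at low
  density and eventually in `N`, implies the crux `SquareSummableInfluence` — via `stub_uniformWindow`
  (with `E₀(N, L') < ⊤` eventually from `eventually_exists_groundStates_succBox`) and the landed equivalence
  of the crux with its ground-state form (`squareSummableInfluence_of_groundStateForm`, p153840).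

So the crux A2 is closed by ONE statement about the true Dirichlet ground states at fixed small density,
uniformly in `N`: every `N`-body ground state in the `(N+1)`-box is predicted bath-particle-by-bath-particle
by some `(N+1)`-body ground state with total squared influence `≤ ε` (the dressed, square-integrable
one-bath-particle influence; `I ≈ 10.6 √(ρa³)` heuristically).
-/

noncomputable section

open MeasureTheory Filter
open scoped ENNReal NNReal Topology

namespace Summit.AtomisticToContinuum.BoseEinsteinCondensation.Theorems.SquareSummableInfluence

open Literature.MathematicalPhysics.QuantumManyBody.BoseGas
open Summit.AtomisticToContinuum.BoseEinsteinCondensation.Theorems.GroundStateRigidity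

/-! ### A uniform window of near-minimisers from the all-ground-states form -/

/-- **A uniform window of near-minimisers from the all-ground-states form (frame, no nondegeneracy).** At
fixed `(N, L, v)` with `E₀(N, L) < ⊤`: if every ground state `Θ₀` of `N` bodies is predicted with tolerance
`ε` from some `(N+1)`-body ground state by bounded measurable predictors blind to `x_i`, then for some slack
`δ₂ > 0` every `δ₂`-near-minimiser `Θ` is so predicted with tolerance `3ε`. By contradiction: badly
predicted near-minimisers of slack `1/(n+1)` have (`stub_compactness`) an `L²`-convergent subsequence whose
limit is a ground state (`IsGroundState.of_tendstoL2`); its predictors serve the tail of the subsequence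
by the `L²`-Lipschitz estimate `stub_influenceLipschitz`.
[cite: ReedSimonIV1978, §XIII.12 Thm XIII.64; Kato1966, VI §1.3 Thm 1.16] -/
theorem stub_uniformWindow :
    ∀ (N : ℕ) (L : ℝ) (v : ℝ → ℝ≥0∞) (ε : ℝ), 0 < ε → groundStateEnergy v N L ≠ ⊤ →
      (∀ Θ₀ : Config N → ℂ, IsGroundState v L Θ₀ →
        ∃ Ψ₀ : Config (N + 1) → ℂ, IsGroundState v L Ψ₀ ∧
        ∃ g : Fin N → Config (N + 1) → ℂ,
          (∀ i, Measurable (g i)) ∧ (∃ M : ℝ, ∀ i Z, ‖g i Z‖ ≤ M) ∧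
          (∀ i Z x, g i (Function.update Z (Fin.succ i) x) = g i Z) ∧
          (∑ i : Fin N, ∫⁻ Z in boxN (N + 1) L,
              (‖Ψ₀ Z - g i Z * Θ₀ (Matrix.vecTail Z)‖₊ : ℝ≥0∞) ^ 2) ≤ ENNReal.ofReal ε) →
      ∃ δ₂ : ℝ≥0∞, 0 < δ₂ ∧ ∀ Θ : TrialState N L,
        energy v Θ ≤ groundStateEnergy v N L + δ₂ →
        ∃ Ψ₀ : Config (N + 1) → ℂ, IsGroundState v L Ψ₀ ∧
        ∃ g : Fin N → Config (N + 1) → ℂ,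
          (∀ i, Measurable (g i)) ∧ (∃ M : ℝ, ∀ i Z, ‖g i Z‖ ≤ M) ∧
          (∀ i Z x, g i (Function.update Z (Fin.succ i) x) = g i Z) ∧
          (∑ i : Fin N, ∫⁻ Z in boxN (N + 1) L,
              (‖Ψ₀ Z - g i Z * Θ.ψ (Matrix.vecTail Z)‖₊ : ℝ≥0∞) ^ 2) ≤ ENNReal.ofReal (3 * ε) := by
  intro N L v ε hε hE H
  by_contra hcon
  push Not at hcon
  -- a vanishing sequence of slacks and, for each, a badly predicted near-minimiser
  obtain ⟨δ, hδpos, hδle, hδ0⟩ := exists_tolerances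
  choose Θs hΘe hfar using fun n => hcon (δ n) (hδpos n)
  -- uniform energy bound `E₀ + 1 < ⊤`
  have hEtop : groundStateEnergy v N L + 1 ≠ ⊤ :=
    ENNReal.add_ne_top.2 ⟨hE, ENNReal.one_ne_top⟩
  have hΘb : ∀ n, energy v (Θs n) ≤ groundStateEnergy v N L + 1 := fun n =>
    (hΘe n).trans (add_le_add le_rfl (hδle n))
  -- compactness: a subsequence converging in `L²` to an admissible `f`
  obtain ⟨f, φ, hφ, hfm, hf0, hfσ, hf⟩ := stub_compactness N L v _ Θs hEtop hΘb
  -- the `liminf` of the energies along `φ` is `≤ E₀`, so `f` is a ground state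
  have hup : Tendsto (fun n => groundStateEnergy v N L + δ (φ n)) atTop
      (𝓝 (groundStateEnergy v N L)) := by
    have h := (hδ0.comp hφ.tendsto_atTop).const_add (groundStateEnergy v N L)
    rw [add_zero] at h
    exact h
  have hlim : liminf (fun n => energy v (Θs (φ n))) atTop ≤ groundStateEnergy v N L :=
    (liminf_le_liminf (Eventually.of_forall fun n => hΘe (φ n))).trans hup.liminf_eq.le
  have hfG : IsGroundState v L f := IsGroundState.of_tendstoL2 hfm hf0 hfσ hE hf hlim
  -- the predictors of the limit ground state
  obtain ⟨Ψ₀, hΨ₀, g, hgm, ⟨M, hgb⟩, hgu, hsum⟩ := H f hfG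
  -- the Lipschitz constant (made nonnegative) and the `L²`-tolerance it allows
  set K : ℝ := (N : ℝ) * |M ^ 2 * L ^ 3| with hK
  have hK0 : 0 ≤ K := by positivity
  set η : ℝ := ε / (2 * K + 1) with hη
  have hηpos : 0 < η := by positivity
  -- far enough along the subsequence, `∫ |Θ_{φ n} − f|² < η`
  have hη' : (0 : ℝ≥0∞) < ENNReal.ofReal η := ENNReal.ofReal_pos.2 hηpos
  obtain ⟨n, hn⟩ := ((tendsto_order.1 hf).2 _ hη').exists
  have hd : ∫⁻ X, (‖f X - 1 * (Θs (φ n)).ψ X‖₊ : ℝ≥0∞) ^ 2 ≤ ENNReal.ofReal η := by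
    refine le_of_eq_of_le (lintegral_congr fun X => ?_) hn.le
    rw [one_mul, ← nnnorm_neg, neg_sub]
  -- Lipschitz transfer of the influence bound from `f` to `Θ_{φ n}`
  have hΘm : Measurable (Θs (φ n)).ψ := (Θs (φ n)).contDiff.continuous.measurable
  have hstep := stub_influenceLipschitz N L Ψ₀ f (Θs (φ n)).ψ g M 1 hΨ₀.measurable hfG.measurable
    hΘm hgm hgb
  simp only [one_mul] at hstep hd
  -- arithmetic of the constants
  have hfin : 2 * ε + 2 * K * η ≤ 3 * ε := by
    have hB : 2 * K * η = ε * (2 * K / (2 * K + 1)) := by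
      rw [hη]
      field_simp
    have hB' : 2 * K / (2 * K + 1) ≤ 1 := by
      rw [div_le_one (by positivity)]
      linarith
    have h2' : ε * (2 * K / (2 * K + 1)) ≤ ε * 1 := by gcongr
    rw [hB]
    linarith
  have habs : ENNReal.ofReal (M ^ 2 * L ^ 3) ≤ ENNReal.ofReal (|M ^ 2 * L ^ 3|) :=
    ENNReal.ofReal_le_ofReal (le_abs_self _)
  have hcast : (2 : ℝ≥0∞) * ENNReal.ofReal ε +
      2 * (N : ℝ≥0∞) * ENNReal.ofReal (|M ^ 2 * L ^ 3|) * ENNReal.ofReal η =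
      ENNReal.ofReal (2 * ε + 2 * K * η) := by
    rw [hK]
    have habs0 : 0 ≤ |M ^ 2 * L ^ 3| := abs_nonneg _
    simp (disch := positivity) only [ENNReal.ofReal_add, ENNReal.ofReal_mul, ENNReal.ofReal_ofNat,
      ENNReal.ofReal_natCast]
    ring
  have hgood : (∑ i : Fin N, ∫⁻ Z in boxN (N + 1) L,
      (‖Ψ₀ Z - g i Z * (Θs (φ n)).ψ (Matrix.vecTail Z)‖₊ : ℝ≥0∞) ^ 2) ≤ ENNReal.ofReal (3 * ε) :=
    calc (∑ i : Fin N, ∫⁻ Z in boxN (N + 1) L,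
          (‖Ψ₀ Z - g i Z * (Θs (φ n)).ψ (Matrix.vecTail Z)‖₊ : ℝ≥0∞) ^ 2)
        ≤ 2 * (∑ i : Fin N, ∫⁻ Z in boxN (N + 1) L,
              (‖Ψ₀ Z - g i Z * f (Matrix.vecTail Z)‖₊ : ℝ≥0∞) ^ 2) +
            2 * (N : ℝ≥0∞) * ENNReal.ofReal (M ^ 2 * L ^ 3) *
              ∫⁻ X, (‖f X - (Θs (φ n)).ψ X‖₊ : ℝ≥0∞) ^ 2 := hstep
      _ ≤ 2 * ENNReal.ofReal ε +
            2 * (N : ℝ≥0∞) * ENNReal.ofReal (|M ^ 2 * L ^ 3|) * ENNReal.ofReal η := by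
          gcongr
      _ ≤ ENNReal.ofReal (3 * ε) := by
          rw [hcast]
          exact ENNReal.ofReal_le_ofReal hfin
  -- contradiction with the choice of `Θ_{φ n}`
  exact lt_irrefl _ ((hfar (φ n) Ψ₀ hΨ₀ g hgm ⟨M, hgb⟩ hgu).trans_le hgood)

/-! ### Reduction v3: the crux from the all-ground-states pair form alone -/

/-- **Reduction (skeleton v3): the all-ground-states pair form implies `SquareSummableInfluence`, with no
nondegeneracy input.** If, for every repulsive finite-range `v` and `ε > 0`, at low density and eventually in
`N`, EVERY ground state `Θ₀` of `N` bodies in the Dirichlet box of side `((N+1)/ρ)^{1/3}` is predicted with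
tolerance `ε` from some `(N+1)`-body ground state `Ψ₀` by bounded measurable predictors blind to `x_i`, then
the crux holds: apply the hypothesis at `ε/3`; eventually `E₀(N, L') < ⊤`
(`eventually_exists_groundStates_succBox`); `stub_uniformWindow` gives the ground-state form of the crux on a
slack window with tolerance `ε`; the ground-state form is the crux (`squareSummableInfluence_of_groundStateForm`).
[cite: ReedSimonIV1978, §XIII.12 Thm XIII.46 and Thm XIII.64] -/
theorem squareSummableInfluence_of_allGroundStatesForm :
    (∀ v : ℝ → ℝ≥0∞, IsRepulsiveFiniteRange v → ∀ ε : ℝ, 0 < ε →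
      ∃ ρ₀ : ℝ, 0 < ρ₀ ∧ ∀ ρ : ℝ, 0 < ρ → ρ < ρ₀ → ∀ᶠ N : ℕ in atTop,
        ∀ Θ₀ : Config N → ℂ, IsGroundState v (sideLength ρ (N + 1)) Θ₀ →
          ∃ Ψ₀ : Config (N + 1) → ℂ, IsGroundState v (sideLength ρ (N + 1)) Ψ₀ ∧
          ∃ g : Fin N → Config (N + 1) → ℂ,
            (∀ i, Measurable (g i)) ∧ (∃ M : ℝ, ∀ i Z, ‖g i Z‖ ≤ M) ∧
            (∀ i Z x, g i (Function.update Z (Fin.succ i) x) = g i Z) ∧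
            (∑ i : Fin N, ∫⁻ Z in boxN (N + 1) (sideLength ρ (N + 1)),
                (‖Ψ₀ Z - g i Z * Θ₀ (Matrix.vecTail Z)‖₊ : ℝ≥0∞) ^ 2) ≤ ENNReal.ofReal ε) →
    Summit.AtomisticToContinuum.BoseEinsteinCondensation.Theses.BECHeatBathGap.SquareSummableInfluence := by
  intro hAll
  refine squareSummableInfluence_of_groundStateForm fun v hv ε hε => ?_
  obtain ⟨ρ₁, hρ₁, H1⟩ := hAll v hv (ε / 3) (by positivity)
  obtain ⟨ρ₂, hρ₂, H2⟩ := eventually_exists_groundStates_succBox v hv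
  refine ⟨min ρ₁ ρ₂, lt_min hρ₁ hρ₂, fun ρ hρ hρlt => ?_⟩
  filter_upwards [H1 ρ hρ (hρlt.trans_le (min_le_left _ _)),
    H2 ρ hρ (hρlt.trans_le (min_le_right _ _))] with N hN1 hN2
  obtain ⟨⟨Θ₁, hΘ₁⟩, -⟩ := hN2
  have hE : groundStateEnergy v N (sideLength ρ (N + 1)) ≠ ⊤ := hΘ₁.groundStateEnergy_ne_top
  obtain ⟨δ₂, hδ₂, hwin⟩ :=
    stub_uniformWindow N (sideLength ρ (N + 1)) v (ε / 3) (by positivity) hE hN1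
  refine ⟨δ₂, hδ₂, fun Θ hΘe => ?_⟩
  obtain ⟨Ψ₀, hΨ₀, g, hgm, hgb, hgu, hsum⟩ := hwin Θ hΘe
  refine ⟨Ψ₀, hΨ₀, g, hgm, hgb, hgu, ?_⟩
  have h3 : 3 * (ε / 3) = ε := by ring
  rwa [h3] at hsum

end Summit.AtomisticToContinuum.BoseEinsteinCondensation.Theorems.SquareSummableInfluence

end
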